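import Summits.Ventures.PercRepro.RankLevelSetLevelSixT11Cell7
import Summits.Ventures.PercRepro.RankLevelSetLevelSixT11Cell8
import Summits.Ventures.PercRepro.RankLevelSetLevelSixT11Cell9
import Summits.Ventures.PercRepro.RankLevelSetLevelSixT11Cell10
import Summits.Ventures.PercRepro.RankLevelSetLevelSixT11Cell11
import Summits.Ventures.PercRepro.RankLevelSetLevelSixT11Cell12
import Summits.Ventures.PercRepro.RankLevelSetLevelSixT11Cell13
import Summits.Ventures.PercRepro.RankLevelSetLevelSixT11Cell14
import Summits.Ventures.PercRepro.RankLevelSetLevelSixT11Cell15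
import Summits.Ventures.PercRepro.RankLevelSetLevelSixT11Cell16
import Summits.Ventures.PercRepro.RankLevelSetLevelSixT11Cell17
import Summits.Ventures.PercRepro.RankLevelSetLevelSixT11Cell18
import Summits.Ventures.PercRepro.RankLevelSetLevelSixT11Cell19
import Summits.Ventures.PercRepro.RankLevelSetLevelSixT11Cell20
import Summits.Ventures.PercRepro.RankLevelSetLevelSixT11Cell21
import Summits.Ventures.PercRepro.RankLevelSetLevelSixT11Cell22
import Summits.Ventures.PercRepro.RankLevelSetLevelSixT11Cell23
import Summits.Ventures.PercRepro.RankLevelSetLevelSixT11Cell24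
import Summits.Ventures.PercRepro.RankLevelSetLevelSixT11Cell25
import Summits.Ventures.PercRepro.RankLevelSetLevelSixT11Cell26
import Summits.Ventures.PercRepro.RankLevelSetLevelSixT11Cell27
import Summits.Ventures.PercRepro.RankLevelSetLevelSixT11Cell28
import Summits.Ventures.PercRepro.RankLevelSetLevelSixT11Cell29
import Summits.Ventures.PercRepro.RankLevelSetLevelSixT11Cell30
import Summits.Ventures.PercRepro.RankLevelSetLevelSixT11Cell31
import Summits.Ventures.PercRepro.RankLevelSetLevelSixT11Cell32
import Summits.Ventures.PercRepro.RankLevelSetLevelSixT11Cell33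
import Summits.Ventures.PercRepro.RankLevelSetLevelSixT11Cell34
import Summits.Ventures.PercRepro.RankLevelSetLevelSixT11Cell35
import Summits.Ventures.PercRepro.S3MidKeyEleven
import Summits.Ventures.PercRepro.S3SixWindow
import Summits.Ventures.PercRepro.RankLevelSetLevelFiveLadder

/-!
# PercRepro — THE 11 ROW'S CORE: `c025_core_six_eleven (d ≥ 7) : RLS M 11 6` — EVERY `e`-FREE CORE OF RANK `11` AT LEVEL `6`, AND THE
ROW 11 GIVEN THE ROW 12 (p7 g22, S3 feeder; p8's assembly shape; tools/gen_rowP.py)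

The core cells `(11, d)`: `7 ≤ d ≤ 35` by the coloop device with the lossy ladder on the natural cells of the rows `11 − k`
(`c025_core_six_eleven_<d>`), `d ≥ 36` by the middle key (`S3Mid.c025_core_six_midkey_eleven`, no coloop-freeness needed). Then the
level-5 glue `rls_six_at_of_core 11` on `c025_five_all` (level `5` at `p = 10`) gives level `6` at `p = 11`; with the 12 row
this is the 11 row: **`c025_six_large_eleven_of_twelve`**.
Axioms: standard.
-/

open scoped Matroid

namespace PercRepro

namespace ThmN

variable {α : Type}

/-- **The core cell `(11, d)` at every corank `d ≥ 7`, every `e`-free core.** -/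
theorem c025_core_six_eleven (M : Matroid α) [M.Finite] (d : ℕ) (hd7 : 7 ≤ d)
    (hR : M.eRank = (11 : ℕ∞)) (hn : M.E.ncard = 11 + d)
    (hfree : ∀ e ∈ M.E, ∃ A ⊆ M.E \ {e}, e ∉ M.closure A ∧ e ∉ M.closure ((M.E \ {e}) \ A)) :
    RLS M 11 6 := by
  rcases Nat.lt_or_ge d 36 with hlt | hge
  · interval_cases d
    · exact c025_core_six_eleven_7 M hR hn hfree
    · exact c025_core_six_eleven_8 M hR hn hfree
    · exact c025_core_six_eleven_9 M hR hn hfree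
    · exact c025_core_six_eleven_10 M hR hn hfree
    · exact c025_core_six_eleven_11 M hR hn hfree
    · exact c025_core_six_eleven_12 M hR hn hfree
    · exact c025_core_six_eleven_13 M hR hn hfree
    · exact c025_core_six_eleven_14 M hR hn hfree
    · exact c025_core_six_eleven_15 M hR hn hfree
    · exact c025_core_six_eleven_16 M hR hn hfree
    · exact c025_core_six_eleven_17 M hR hn hfree
    · exact c025_core_six_eleven_18 M hR hn hfree
    · exact c025_core_six_eleven_19 M hR hn hfree
    · exact c025_core_six_eleven_20 M hR hn hfree
    · exact c025_core_six_eleven_21 M hR hn hfree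
    · exact c025_core_six_eleven_22 M hR hn hfree
    · exact c025_core_six_eleven_23 M hR hn hfree
    · exact c025_core_six_eleven_24 M hR hn hfree
    · exact c025_core_six_eleven_25 M hR hn hfree
    · exact c025_core_six_eleven_26 M hR hn hfree
    · exact c025_core_six_eleven_27 M hR hn hfree
    · exact c025_core_six_eleven_28 M hR hn hfree
    · exact c025_core_six_eleven_29 M hR hn hfree
    · exact c025_core_six_eleven_30 M hR hn hfree
    · exact c025_core_six_eleven_31 M hR hn hfree
    · exact c025_core_six_eleven_32 M hR hn hfree
    · exact c025_core_six_eleven_33 M hR hn hfree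
    · exact c025_core_six_eleven_34 M hR hn hfree
    · exact c025_core_six_eleven_35 M hR hn hfree
  · exact S3Mid.c025_core_six_midkey_eleven M d hge hR hn hfree

/-- **THEOREM C₆ AT RANK `11`**: level `6` at `p = 11` for every finite matroid (on level `5` at `p = 10`, `c025_five_all`). -/
theorem c025_six_at_eleven (M : Matroid α) [M.Finite] : RLS M 11 6 :=
  rls_six_at_of_core 11 (by norm_num) (fun M _ => c025_five_all M 10 (by norm_num))
    (fun M _ d hd hR hn hfree => c025_core_six_eleven M d hd hR hn hfree) M

/-- **THE 11 ROW GIVEN THE 12 ROW**: C-025 at level `6` for every `p ≥ 11`, every finite matroid, from the 12 row. -/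
theorem c025_six_large_eleven_of_twelve (h : ∀ (M : Matroid α) [M.Finite] (p : ℕ), 12 ≤ p → RLS M p 6)
    (M : Matroid α) [M.Finite] (p : ℕ) (hp : 11 ≤ p) : RLS M p 6 := by
  rcases Nat.lt_or_ge p 12 with hlt | hge
  · have hP : p = 11 := by omega
    subst hP
    exact c025_six_at_eleven M
  · exact h M p hge

end ThmN

end PercRepro
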